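import Summits.CriticalPhenomena.PercolationContinuityZ3.Theorems.Transplant.KNLevelsStepV
import Summits.CriticalPhenomena.PercolationContinuityZ3.Theorems.Transplant.KNLevelsAffineGluing
import HarnessLib

/-!
# Kozma–Nitzan Lemma 10, STEP V with a LINEAR accuracy transfer: the affine gluing inequality (the lane's proved `AdditiveGluing`)
# averaged over the shell patterns, in place of Conjecture 3 + Markov (companion of `KNLevelsStepV`; P5-SHARPNESS §17.7 (iv))

builds on p205010 (kernel theorem, internal audit signed; external expert review pending): uses `KNLevels.affineGluing_setIn`
(`KNLevelsAffineGluing`, = the tree theorem `AdditiveGluing_proof` transported).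
Status sentence (coordinator 2026-08-20T04:30Z): "θ(p_c) = 0 on ℤ^d, all d ≥ 2 — kernel-verified (Lean 4/Mathlib, standard axioms); internal
adversarial audit SIGNED 2026-08-20 04:29Z; external expert review pending."
Lane `prim-bschramm`, seat p5 (refuter, generation 2); helper file (`--supports stmt-CriticalPhenomena-4575`).

Kozma–Nitzan's Step V (arXiv:2401.12397 §4 pp. 21–22) splits the shell patterns `ξ` into good (`φ_ξ > 1 − δ_{C3}`) and bad ones, bounds the
bad mass by Markov (`≤ 6δ/δ_{C3}`), and applies the ε–δ gluing (Conjecture 3) on the good ones; this forces `12δ ≤ ε·δ_{C3}`, i.e. a QUADRATIC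
accuracy transfer `δ ≍ ε²` per Lemma-10 step and `ε^{2^n}` along a chain of `n` steps.  With the AFFINE inequality
`P_w(o ↔ A_ξ) − δ ≤ P_w(o ↔ T)` (relays `δ`-reliable inside the region) available in EVERY pinned weighting `K_ξ`, no splitting is needed:
`P(o ↔ T) = Σ_ξ p_ξ P_{K_ξ}(o ↔ T) ≥ Σ_ξ p_ξ φ_ξ − δ > (1 − 3δ)² − δ ≥ 1 − 7δ`.
* **`LHyp.stepV_in_affine`** — same inputs as `LHyp.stepV_in` (Step II count, Step III seed bound, Step IV face estimate at accuracy `δ`, shell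
  facts) WITHOUT `ε`, `δ_{C3}`, `h12` or a gluing hypothesis (the affine gluing is a tree theorem), conclusion `1 − 7δ < P_W(o ↔ T)`.
Universe note: `AdditiveGluing` is typed over `Fin n`, so this file is over `V : Type` (like `KNLevelsTargetLemmaKN`).
Proof: `stepV_in`'s Claims A–D verbatim (the first-seed decomposition and the averaged estimate (26)), then the affine summation.

[cite: KozmaNitzan2024, §4 Lemma 10, pp. 21–22 (Step V, (26)); Conjecture 1 (p. 3)] [cite: GrimmettPercolation1999, §7.2]
-/

noncomputable section

open MeasureTheory ProbabilityTheory
open scoped ENNReal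

namespace Summit.CriticalPhenomena.PercolationContinuityZ3.Theorems

namespace Transplant

namespace KNLevels

open Literature.Probability.Percolation Literature.Probability.LatticeModels SimpleGraph

variable {V : Type} [DecidableEq V] {G : SimpleGraph V} [G.LocallyFinite]

namespace LHyp

variable {L : LData G} {W : Sym2 V → unitInterval} {p : unitInterval} {D : Finset V} {R : ℕ}
variable (hL : LHyp L W p D R)
include hL

open Classical in
/-- **Step V with a LINEAR transfer** (KN pp. 21–22 over the levels of `G`, affine form): a level `j ≤ R` with `≥ N` contacts with probability
`> 1 − 2δ` (Step II), seed data with `(1 − p^{sB})^k ≤ δ` (Step III), a shell `S ⊆ B⟨j⟩ ∩ D` containing every face and avoided by every seed,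
and the Step-IV estimate "with probability `≥ 1 − 3δ` some `u ∈ face x` has `P(u ↔ T inside Rg | ω|_{E(S)}) > 1 − δ`" for every candidate
contact give `P_W(o ↔ T) > 1 − 7δ` — by the first-seed decomposition, the averaged estimate (26) `Σ_ξ p_ξ φ_ξ > (1−3δ)²`, and the AFFINE
gluing inequality `P_{K_ξ}(o ↔ A_ξ) − δ ≤ P_{K_ξ}(o ↔ T)` in every pinned weighting (`affineGluing_setIn`, the tree's `AdditiveGluing`).
No `ε`–`δ_{C3}` bookkeeping: the loss is `3δ + 3δ + δ`. [cite: KozmaNitzan2024, §4 pp. 21–22 (Step V); Conjecture 1 (p. 3)] -/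
theorem stepV_in_affine [Countable V] {σ : SData V} {j : ℕ} (hσ : SHyp L j σ) (hj : j ≤ R) {Rg : Set V}
    {S T : Finset V} (hSX : S ⊆ L.X j) (hSD : S ⊆ D)
    (hSseed : ∀ x ∈ σ.K, ∀ e ∈ σ.seed x, e ∉ wireSet (↑S : Set V))
    (hTD : T ⊆ D) (hTne : T.Nonempty)
    {δ : ℝ} (hδ : 0 < δ) (h3δ : 3 * δ ≤ 1)
    (hII : 1 - 2 * δ < (prodBernoulli W).real (L.Fail σ.N j)ᶜ)
    (hIII : (1 - (p : ℝ) ^ σ.sB) ^ σ.k ≤ δ)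
    (hUS : ∀ x ∈ σ.K, σ.face x ⊆ S)
    (hIV : ∀ x ∈ σ.K,
      1 - 3 * δ ≤ (prodBernoulli W).real {ω | ∃ u ∈ σ.face x,
        1 - δ < (prodBernoulli (pinW W (wireSet (↑S : Set V)) ω)).real (⋃ t ∈ T, openConnIn Rg u t)}) :
    1 - 7 * δ < (prodBernoulli W).real (⋃ t ∈ T, openConn L.o t) := by
  set μ := prodBernoulli W with hμ
  set OB := σ.K with hOB
  set F := pairsF S with hF
  have hFS : (↑F : Set (Sym2 V)) = wireSet (↑S : Set V) := coe_pairsF S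
  have hSfin : S ⊆ L.Sfin := hSD.trans hL.DS
  -- the good sets `A_ξ` and the quantities `φ_ξ`
  set Aof : Finset (Sym2 V) → Finset V := fun P => S.filter fun u =>
    1 - δ < (prodBernoulli (pinW W (wireSet (↑S : Set V)) ↑P)).real (⋃ t ∈ T, openConnIn Rg u t) with hAof
  set φ : Finset (Sym2 V) → ℝ := fun P =>
    (prodBernoulli (pinW W ↑F ↑P)).real (⋃ a ∈ Aof P, openConn L.o a) with hφ
  set cyl : Finset (Sym2 V) → Set (BondConfig V) := fun P => localCylinder ↑F ↑P with hcyl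
  -- `μ(𝒢) > 1 - 3δ`
  have hG : 1 - 3 * δ < μ.real (L.Gev σ j) := by
    have hmG : MeasurableSet (L.Gev σ j) := LData.measurableSet_Gev j
    have h1 := hL.real_manyContacts_diff_Gev_le hσ hj
    have h2 : μ.real (L.Fail σ.N j)ᶜ ≤ μ.real ((L.Fail σ.N j)ᶜ \ L.Gev σ j) + μ.real (L.Gev σ j) := by
      rw [← measureReal_inter_add_sdiff (s := (L.Fail σ.N j)ᶜ) hmG, add_comm]
      exact add_le_add le_rfl (measureReal_mono Set.inter_subset_right)
    linarith
  -- Claim D: `Σ_P μ(cyl P) φ(P) ≥ (1 - 3δ) μ(𝒢)`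
  have hGood_det : ∀ x, DeterminedBy {ω | ∃ u ∈ σ.face x,
      1 - δ < (prodBernoulli (pinW W (wireSet (↑S : Set V)) ω)).real (⋃ t ∈ T, openConnIn Rg u t)} ↑F := by
    intro x
    rw [determinedBy_iff]
    intro ω ω' hω
    simp only [Set.mem_setOf_eq]
    have hag : ∀ e ∈ wireSet (↑S : Set V), e ∈ ω ↔ e ∈ ω' := by
      intro e he
      rw [← hFS] at he
      have := Set.ext_iff.1 hω e
      simp only [Set.mem_inter_iff] at this
      exact ⟨fun h' => (this.1 ⟨h', he⟩).1, fun h' => (this.2 ⟨h', he⟩).1⟩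
    refine exists_congr fun u => and_congr_right fun _ => ?_
    rw [pinW_congr W hag]
  have hFx_pin : ∀ P, ∀ x ∈ OB, (prodBernoulli (pinW W ↑F ↑P)).real (L.Fx σ j x) = μ.real (L.Fx σ j x) := by
    intro P x hx
    rw [hμ]
    refine (prodBernoulli_real_eq_of_determinedBy W _ (F := (↑F : Set (Sym2 V))ᶜ)
      (fun e he => (pinW_apply_of_not_mem W ↑P he).symm) ?_ (LData.measurableSet_Fx j x)).symm
    rw [hFS]
    exact LData.determinedBy_Fx hSX hSseed hx
  have hφ_ge : ∀ P, P ⊆ F →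
      ∑ x ∈ OB.filter (fun x => ∃ u ∈ σ.face x, u ∈ Aof P), μ.real (L.Fx σ j x) ≤ φ P := by
    intro P hP
    have hsub : (⋃ x ∈ OB.filter (fun x => ∃ u ∈ σ.face x, u ∈ Aof P), L.Fx σ j x) ⊆
        ⋃ a ∈ Aof P, openConn L.o a := by
      intro ω hω
      simp only [Set.mem_iUnion, exists_prop, Finset.mem_filter] at hω ⊢
      obtain ⟨x, ⟨-, u, hu, huA⟩, hFx⟩ := hω
      exact ⟨u, huA, LData.openConn_of_mem_oSeed hσ (LData.Fx_subset_oSeed x hFx) hu⟩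
    calc _ = ∑ x ∈ OB.filter (fun x => ∃ u ∈ σ.face x, u ∈ Aof P),
            (prodBernoulli (pinW W ↑F ↑P)).real (L.Fx σ j x) :=
          Finset.sum_congr rfl fun x hx => (hFx_pin P x (Finset.mem_filter.1 hx).1).symm
      _ = (prodBernoulli (pinW W ↑F ↑P)).real
            (⋃ x ∈ OB.filter (fun x => ∃ u ∈ σ.face x, u ∈ Aof P), L.Fx σ j x) := by
          rw [measureReal_biUnion_finset]
          · intro x hx x' hx' hne
            exact LData.Fx_disjoint hne (Finset.mem_filter.1 hx').1 (Finset.mem_filter.1 hx).1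
          · intro x _; exact LData.measurableSet_Fx j x
      _ ≤ φ P := measureReal_mono hsub (measure_ne_top _ _)
  have hD : (1 - 3 * δ) * μ.real (L.Gev σ j) ≤ ∑ P ∈ F.powerset, μ.real (cyl P) * φ P := by
    -- `Σ_x μ(F_x) μ(Good_x) = Σ_P μ(cyl P) Σ_{x good for P} μ(F_x)`
    have hGx : ∀ x ∈ OB, μ.real {ω | ∃ u ∈ σ.face x,
        1 - δ < (prodBernoulli (pinW W (wireSet (↑S : Set V)) ω)).real (⋃ t ∈ T, openConnIn Rg u t)} =
        ∑ P ∈ F.powerset.filter (fun P => ∃ u ∈ σ.face x, u ∈ Aof P), μ.real (cyl P) := by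
      intro x hx
      rw [hμ, prodBernoulli_real_eq_sum_localCylinder W F (hGood_det x)]
      refine Finset.sum_congr ?_ fun P _ => rfl
      ext P
      simp only [Finset.mem_filter, Finset.mem_powerset, Set.mem_setOf_eq, hAof, and_congr_right_iff]
      intro _
      constructor
      · rintro ⟨u, hu, hg⟩; exact ⟨u, hu, hUS x hx hu, hg⟩
      · rintro ⟨u, hu, -, hg⟩; exact ⟨u, hu, hg⟩
    calc (1 - 3 * δ) * μ.real (L.Gev σ j)
        = ∑ x ∈ OB, (1 - 3 * δ) * μ.real (L.Fx σ j x) := by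
          rw [← LData.biUnion_Fx_eq_Gev, measureReal_biUnion_finset, Finset.mul_sum]
          · intro x hx x' hx' hne; exact LData.Fx_disjoint hne hx' hx
          · intro x _; exact LData.measurableSet_Fx j x
      _ ≤ ∑ x ∈ OB, μ.real {ω | ∃ u ∈ σ.face x,
            1 - δ < (prodBernoulli (pinW W (wireSet (↑S : Set V)) ω)).real (⋃ t ∈ T, openConnIn Rg u t)} *
            μ.real (L.Fx σ j x) :=
          Finset.sum_le_sum fun x hx => mul_le_mul_of_nonneg_right (hIV x hx) measureReal_nonneg
      _ = ∑ x ∈ OB, ∑ P ∈ F.powerset.filter (fun P => ∃ u ∈ σ.face x, u ∈ Aof P),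
            μ.real (cyl P) * μ.real (L.Fx σ j x) := by
          refine Finset.sum_congr rfl fun x hx => ?_
          rw [hGx x hx, Finset.sum_mul]
      _ = ∑ P ∈ F.powerset, ∑ x ∈ OB.filter (fun x => ∃ u ∈ σ.face x, u ∈ Aof P),
            μ.real (cyl P) * μ.real (L.Fx σ j x) := by
          rw [Finset.sum_comm' (t' := F.powerset)
            (s' := fun P => OB.filter (fun x => ∃ u ∈ σ.face x, u ∈ Aof P))]
          intro x P
          simp only [Finset.mem_filter, Finset.mem_powerset]
          tauto
      _ = ∑ P ∈ F.powerset, μ.real (cyl P) *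
            ∑ x ∈ OB.filter (fun x => ∃ u ∈ σ.face x, u ∈ Aof P), μ.real (L.Fx σ j x) := by
          refine Finset.sum_congr rfl fun P _ => ?_
          rw [Finset.mul_sum]
      _ ≤ ∑ P ∈ F.powerset, μ.real (cyl P) * φ P :=
          Finset.sum_le_sum fun P hP => mul_le_mul_of_nonneg_left (hφ_ge P (Finset.mem_powerset.1 hP)) measureReal_nonneg
  -- total mass of the cylinders is `1`
  have hcyl_sum : ∑ P ∈ F.powerset, μ.real (cyl P) = 1 := by
    have := prodBernoulli_real_eq_sum_localCylinder W F (determinedBy_univ (↑F : Set (Sym2 V)))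
    rw [probReal_univ] at this
    rw [hμ, this]
    refine (Finset.sum_congr ?_ fun P _ => rfl)
    ext P; simp
  -- the averaged estimate (26): `Σ_P μ(cyl P) φ(P) > (1 - 3δ)² > 1 - 6δ`
  have h0 : (0 : ℝ) ≤ 1 - 3 * δ := by linarith
  have h2 : (1 - 3 * δ) * (1 - 3 * δ) ≤ ∑ P ∈ F.powerset, μ.real (cyl P) * φ P :=
    (mul_le_mul_of_nonneg_left hG.le h0).trans hD
  have h3 : 1 - 6 * δ < (1 - 3 * δ) * (1 - 3 * δ) := by nlinarith [hδ]
  -- the AFFINE gluing inequality in every pinned weighting: `φ P - δ ≤ P_{K_P}(o ↔ T)`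
  have hAff : ∀ P ∈ F.powerset,
      φ P - δ ≤ (prodBernoulli (pinW W ↑F ↑P)).real (⋃ t ∈ T, openConn L.o t) := by
    intro P _
    have hsupp : FinSupp (pinW W ↑F ↑P) L.Sfin :=
      hL.fin.pinW (F := (↑F : Set (Sym2 V))) ↑P
        (by rw [hFS]; exact KozmaNitzan.wireSet_mono (Finset.coe_subset.2 hSfin))
    refine affineGluing_setIn V (pinW W ↑F ↑P) L.Sfin hsupp.zero (Aof P) T L.o Rg
      ((Finset.filter_subset _ _).trans hSfin) (hTD.trans hL.DS) hL.o_mem hTne hδ.le fun a ha => ?_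
    have hga := (Finset.mem_filter.1 ha).2
    rw [← hFS] at hga
    exact hga.le
  -- conclusion: total probability over the patterns
  have hmT : MeasurableSet (⋃ t ∈ T, openConn L.o t : Set (BondConfig V)) :=
    Finset.measurableSet_biUnion _ fun t _ => measurableSet_openConn_holds _ _
  have htot := prodBernoulli_real_inter_eq_sum_pinW W F hmT (determinedBy_univ (↑F : Set (Sym2 V)))
  rw [Set.inter_univ] at htot
  simp only [Set.mem_univ, Finset.filter_true] at htot
  rw [hμ] at h2 hcyl_sum
  rw [htot]
  calc 1 - 7 * δ < (∑ P ∈ F.powerset, (prodBernoulli W).real (cyl P) * φ P) - δ := by linarith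
    _ = (∑ P ∈ F.powerset, (prodBernoulli W).real (cyl P) * φ P) -
          δ * ∑ P ∈ F.powerset, (prodBernoulli W).real (cyl P) := by rw [hcyl_sum, mul_one]
    _ = ∑ P ∈ F.powerset, (prodBernoulli W).real (cyl P) * (φ P - δ) := by
        rw [Finset.mul_sum, ← Finset.sum_sub_distrib]
        exact Finset.sum_congr rfl fun P _ => by ring
    _ ≤ ∑ P ∈ F.powerset, (prodBernoulli W).real (cyl P) *
          (prodBernoulli (pinW W ↑F ↑P)).real (⋃ t ∈ T, openConn L.o t) :=
        Finset.sum_le_sum fun P hP => mul_le_mul_of_nonneg_left (hAff P hP) measureReal_nonneg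

end LHyp

end KNLevels

end Transplant

end Summit.CriticalPhenomena.PercolationContinuityZ3.Theorems

end
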